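import Literature.AlgebraicGeometry.Hyperkaehler.GeneralizedKummerAutFixingH2H3
import HarnessLib

/-!
# Natural automorphisms of `A^[n+1]` and the cohomologically trivial automorphisms of `Kⁿ(A)`:
# the four SINGLE-SOURCE pieces of `BNWS2011_autFixingH2H3_generalizedKummer`, and the glue (PROVED)

Layer `Literature/AlgebraicGeometry/Hyperkaehler`; rider on `GeneralizedKummerAutFixingH2H3.lean`, whose named fact
`BNWS2011_autFixingH2H3_generalizedKummer` ("`Γ(Kⁿ(A))` = the Kummer translations `τ_b`, `b ∈ A[n+1]`") is a
PRINT-SYNTHESIS of three refereed papers (Boissière–Nieper-Wißkirchen–Sarti 2011, Oguiso 2020, Foster 2024; see that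
file's docstring and the K5 audit `BINDERS.md` §#8).  This file records each printed ingredient SEPARATELY, one named
fact per printed statement, each checkable against ONE page of ONE paper, and PROVES that their conjunction gives the
synthesis fact (`bnws2011_autFixingH2H3_generalizedKummer_of_pieces`, the glue "G8" of the K5 harvest cell: pure
group bookkeeping, kernel-checked).  To state Oguiso's Lemma 3.4 (the coset of `ι`) one notion was missing from the
tree and is defined here, with Boissière's / BNWS's name:

* `AbelianVariety.invTranslate A d : A → A`, `x ↦ x⁻¹ · d` (the involutions `t_d ∘ (−1)_A`; `d = 1`: the inversion
  `ι_A = (−1)_A`), and the self-inverse isomorphism `AbelianVariety.invTranslateIso A d`;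
* `IsNaturalAutomorphism Ξ ψ Ψ` — for a Hilbert scheme `(H, Ξ)` of points of `A` (universal family `Ξ ⊂ A × H`), an
  automorphism `ψ : A ≅ A` of the surface and `Ψ : H ⟶ H`: **`Ψ` is the natural automorphism `ψ^{[n]}` induced by
  `ψ`**, i.e. `Ψ` classifies the family `ψ(Ξ_ξ)`: `(A × Ψ)^* Ξ = (ψ⁻¹ × H)^* Ξ` ("Any biholomorphic map `ψ : A → A`
  induces in a natural way an automorphism `ψ^{[n]} : A^{[n]} → A^{[n]}`, called natural", BNWS §3.1 after Boissière
  2012).  API: `IsNaturalAutomorphism.unique` (universal property), `isNaturalAutomorphism_refl` (`𝟙` is `id^{[n]}`;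
  non-vacuity), `IsNaturalAutomorphism.comp` (`ψ^{[n]} ≫ ψ'^{[n]} = (ψ ≫ ψ')^{[n]}`).  It is the same classifying
  equation as the tree's `IsTranslationAction` / `translatedFamily` (`Ξ_{t_a ξ} = t_a(Ξ_ξ)`), for one automorphism.

## The four pieces (named facts; statements as printed, in the vocabulary of `BNWS2011_autFixingH2H3_generalizedKummer`)

Common setting (verbatim the binder list of the synthesis fact): `A` an abelian surface, `2 ≤ n`, `(H, Ξ)` a Hilbert
scheme of `n + 1` points of `A` (smooth projective of dimension `2(n+1)`) with translation action `act`, `j : K ⟶ H`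
the Kummer fibre through a base point `x₀` (fibre of the Albanese difference map over the unit; `K` smooth projective
of dimension `2n`).  Indexing: tree `Kⁿ(A) ⊂ A^[n+1]` = BNWS `K_{n+1}(A)` = Oguiso `K_n(A) ⊂ Hilb^{n+1}(A)` = Foster
`Kum_n(A)`; BNWS/Oguiso fix the fibre over `0`, all fibres being translates of one another by some `t_c^{[n+1]}`
(Beauville 1983 §7; Oguiso §2 "all fibers are isomorphic"), which conjugates `(−1)_A` into `x ↦ x⁻¹ · d` — whence the
parameter `d` below.

* S8a `BNWS2011_kummerTranslation_isIso_trivialOnH2` — a Kummer translation `τ` by an `(n+1)`-torsion point `b`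
  (`τ ≫ j = j ≫ t_b^{[n+1]}`) is an automorphism of `K` acting as the identity on `H²(K(ℂ); ℂ)`.  PRINT: BNWS §3.1
  "the translation `t_a` by `a` in `A` induces an automorphism of `A^{[n]}` that restricts to `K_n(A)` if and only if
  `a` is an `n`-torsion point of `A`" and proof of Cor. 3.3 (2) "the translation by `a` on `A` induces an automorphism
  `t_a^{⟦n⟧}` acting as the identity on `H²(K_n(A), ℤ)`: since the automorphism `t_a^{[n]}` induced on `A^{[n]}` is
  homotopic to the identity and the restriction map `H²(A^{[n]}, ℂ) → H²(K_n(A), ℂ)` is surjective, `t_a^{⟦n⟧}` acts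
  as the identity on `H²(K_n(A), ℂ)`" [arXiv:1001.4728 p. 6 L7, p. 8 L1].
* S8d `Foster2024_kummerTranslation_trivialOnH3` — the same `τ` acts as the identity on `H³(K(ℂ); ℂ)`.  PRINT:
  Foster, Remark 28 / p. 8 "The group `A[n+1]` of torsion points of `A` of order `n+1` acts on `A^{[n+1]}`. The
  Albanese map is invariant with respect to this action" and proof of Lemma 85 "if `k < 2(n+1)(j−1)/j`, then
  `H^k(A × Kum_n(A), ℚ)` is `Γ`-invariant and by the Künneth theorem this implies that `H^k(Kum_n(A), ℚ)` is
  `Γ`-invariant as well" (`Γ ≅ A[n+1]`, `j` the smallest prime factor of `n + 1`; `k = 3 < 2(n+1)(j−1)/j` for every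
  `n ≥ 2`) [arXiv:2303.14327 p. 8 L50, p. 25 L27–28]; `ℚ`-coefficients give `ℂ`-coefficients by extension of scalars.
* S8b `BNWS2011_autTrivialOnH2_generalizedKummer` — every automorphism `g` of `K` acting as the identity on
  `H²(K(ℂ); ℂ)` is NATURAL of the form `(t_a ∘ (±1)_A)^{⟦n⟧}`: either a Kummer translation by a torsion point, or the
  restriction of the natural automorphism induced by some `x ↦ x⁻¹ · d`.  PRINT: BNWS Cor. 3.3 (2) "The kernel of the
  map `Aut(K_n(A)) → O(H²(K_n(A), ℤ))`, `f ↦ f^*` is isomorphic to `Tors_n(A) ⋊ ℤ/2ℤ`", proof: "`f` leaves `E_0`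
  globally invariant, so by Theorem 3.1 it is a natural automorphism […] The only possibility is `λ = μ = ±1`, so
  `f = ±id`" [p. 7 L81, p. 8 L1]; = Oguiso Thm. 1.2 "`Ker (ρ₂ : Aut(K_{n−1}(A)) → GL(H²(K_{n−1}(A), ℤ))) = T(n)·⟨ι⟩`.
  Here `ι` is the automorphism naturally induced from the inversion `−1` of `A`" [arXiv:1208.3750 p. 3 L29–L33]
  (`H²(K_n(A), ℤ)` has no torsion [BNWS, proof of Cor. 3.3], so trivial on `H²(·, ℂ)` = trivial on `H²(·, ℤ)`).  Only
  the inclusion `Ker ⊆ T·⟨ι⟩` is recorded (the one the synthesis consumes; the converse for translations is S8a).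
* S8c `Oguiso2020_inversionCoset_nontrivialOnH3` — an automorphism of `K` that is the restriction of a natural
  automorphism induced by some `x ↦ x⁻¹ · d` does NOT act as the identity on `H³(K(ℂ); ℂ)`.  PRINT: Oguiso Lemma 3.4
  "Let `g ∈ K ∖ T(n)` [the coset of `ι` in `K = T(n)·⟨ι⟩`] and `τ ∈ H^{2,1}(X)` be as in Lemma 3.3. Then `g^* τ = −τ`.
  In particular, `g` is not cohomologically trivial. […] this implies `g^* | H³(X, ℂ) ≠ id`" (`X = K_{n−1}(A)`,
  `n − 1 ≥ 2`) [p. 5 L65–L72].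

## The glue (PROVED): `S8a → S8d → S8b → S8c → BNWS2011_autFixingH2H3_generalizedKummer`

Clause (1) of the synthesis is S8a ∧ S8d; clause (2): `g ∈ Γ(K)` is trivial on `H²`, hence (S8b) a torsion translation
— done — or in the `ι`-coset, which (S8c) contradicts triviality on `H³`.  This is exactly the "intersection step"
`BNWS Cor. 3.3 (2) ∩ Oguiso Lemma 3.4` that no single paper prints (Floccari–Varesco 2025 §3 print its OUTPUT).

Junk / scope.  All four facts carry the same hypotheses as the synthesis fact (inhabited only by genuine Hilbert
schemes and Kummer fibres; nothing is constructed here).  `IsNaturalAutomorphism` is a predicate (no choice, no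
existence claim); `invTranslate` is total.  Nothing here asserts HC / HC_Kum4Type or any case of the Hodge conjecture;
nothing is asserted for `n = 1`.  NOT here: existence of `ψ^{[n]}` for every `ψ` (representability exercise, as
`Beauville1983_hilbertScheme_translationAction_holds` does for translations), `translateHilb act a` is natural for
`t_a` (true; not needed), the group structure `Tors ⋊ GAut(A) → Aut(Kⁿ(A))` (BNWS Cor. 3.3 (1)), Theorem 3.1 itself.
-/

noncomputable section

open CategoryTheory MonoidalCategory CartesianMonoidalCategory
open Literature.AlgebraicGeometry.Motives (SchemeOver AbelianVariety ComplexPoints)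
open Literature.AlgebraicGeometry.HodgeTheory (complexBetti)
open Literature.AlgebraicGeometry.HilbertScheme
open scoped MonObj

namespace Literature.AlgebraicGeometry.Hyperkaehler

/-! ### The involutions `x ↦ x⁻¹ · d` of an abelian variety (dot-notation extensions of `Motives.AbelianVariety`) -/

section InvTranslate

variable (A : AbelianVariety ℂ)

/-- **The involution `x ↦ x⁻¹ · d` of the abelian variety `A`** (`d` a point `Spec ℂ → A`): the composite of the
inversion `(−1)_A` with the translation by `d`; for `d = 1` this is Oguiso's `ι = −1` on `A`.  Written in the group of
morphisms `A.X ⟶ A.X`: `(toUnit ≫ d) * (𝟙 A)⁻¹`. [cite: Oguiso2020CohomologicallyTrivialKummer, Thm. 1.2 ("ι is the automorphism naturally induced from the inversion −1 of A")]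
[cite: BoissiereNieperWisskirchenSarti2011, §3.1 (ψ = t_{ψ(0)} ∘ h, Aut(A) ≅ A ⋊ GAut(A))] -/
def _root_.Literature.AlgebraicGeometry.Motives.AbelianVariety.invTranslate (d : 𝟙_ (SchemeOver ℂ) ⟶ A.X) : A.X ⟶ A.X :=
  (toUnit A.X ≫ d) * (𝟙 A.X)⁻¹

/-- Unfolding: `invTranslate A d = (toUnit ≫ d) * (𝟙 A)⁻¹`. [cite: BoissiereNieperWisskirchenSarti2011, §3.1] -/
theorem _root_.Literature.AlgebraicGeometry.Motives.AbelianVariety.invTranslate_def (d : 𝟙_ (SchemeOver ℂ) ⟶ A.X) :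
    A.invTranslate d = (toUnit A.X ≫ d) * (𝟙 A.X)⁻¹ :=
  rfl

/-- Precomposition: `f ≫ (x ↦ x⁻¹ · d) = (toUnit ≫ d) * f⁻¹` in the group `Y ⟶ A` (unfolding of the involution
`t_d ∘ (−1)_A` on `Y`-points). [cite: BoissiereNieperWisskirchenSarti2011, §3.1 (ψ = t_{ψ(0)} ∘ h)] -/
theorem _root_.Literature.AlgebraicGeometry.Motives.AbelianVariety.comp_invTranslate {Y : SchemeOver ℂ} (f : Y ⟶ A.X) (d : 𝟙_ (SchemeOver ℂ) ⟶ A.X) :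
    f ≫ A.invTranslate d = (toUnit Y ≫ d) * f⁻¹ := by
  rw [Motives.AbelianVariety.invTranslate_def, MonObj.comp_mul, GrpObj.comp_inv, Category.comp_id, ← Category.assoc, comp_toUnit]

/-- **`x ↦ x⁻¹ · d` is an involution**: `(x⁻¹ d)⁻¹ d = x` (commutativity of `A`) — the `ℤ/2ℤ` of
"`Tors_n(A) ⋊ ℤ/2ℤ`", the order of `ι` in "`T(n)·⟨ι⟩`". [cite: BoissiereNieperWisskirchenSarti2011, Cor. 3.3 (2)]
[cite: Oguiso2020CohomologicallyTrivialKummer, Thm. 1.2] -/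
theorem _root_.Literature.AlgebraicGeometry.Motives.AbelianVariety.invTranslate_comp_invTranslate (d : 𝟙_ (SchemeOver ℂ) ⟶ A.X) :
    A.invTranslate d ≫ A.invTranslate d = 𝟙 A.X := by
  rw [Motives.AbelianVariety.comp_invTranslate, Motives.AbelianVariety.invTranslate_def, mul_inv_rev, inv_inv, mul_comm (𝟙 A.X), mul_inv_cancel_left]

/-- **The involution `x ↦ x⁻¹ · d` as an isomorphism `A ≅ A`** (self-inverse). [cite: Oguiso2020CohomologicallyTrivialKummer, Thm. 1.2]
[cite: BoissiereNieperWisskirchenSarti2011, §3.1] -/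
def _root_.Literature.AlgebraicGeometry.Motives.AbelianVariety.invTranslateIso (d : 𝟙_ (SchemeOver ℂ) ⟶ A.X) : A.X ≅ A.X where
  hom := A.invTranslate d
  inv := A.invTranslate d
  hom_inv_id := A.invTranslate_comp_invTranslate d
  inv_hom_id := A.invTranslate_comp_invTranslate d

/-- Unfolding: both directions of `invTranslateIso A d` are `invTranslate A d` (the involution is its own
inverse). [cite: Oguiso2020CohomologicallyTrivialKummer, Thm. 1.2 (⟨ι⟩)] -/
theorem _root_.Literature.AlgebraicGeometry.Motives.AbelianVariety.invTranslateIso_hom_inv (d : 𝟙_ (SchemeOver ℂ) ⟶ A.X) :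
    (A.invTranslateIso d).hom = A.invTranslate d ∧ (A.invTranslateIso d).inv = A.invTranslate d :=
  ⟨rfl, rfl⟩

end InvTranslate

/-! ### Natural automorphisms of a Hilbert scheme of points (Boissière; BNWS §3.1) -/

section Natural

variable {A : AbelianVariety ℂ} {H : SchemeOver ℂ}

/-- **`Ψ` is the natural automorphism `ψ^{[n]}` of the Hilbert scheme `(H, Ξ)` induced by the automorphism `ψ` of
the surface `A`**: `Ψ : H ⟶ H` classifies the family `ξ ↦ ψ(Ξ_ξ)`, i.e. `(A × Ψ)^* Ξ = (ψ⁻¹ × H)^* Ξ` as closed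
subschemes of `A × H` (the fibre of the right-hand side over `ξ` is `{x | ψ⁻¹ x ∈ Ξ_ξ} = ψ(Ξ_ξ)`).  "Any
biholomorphic map `ψ : A → A` induces in a natural way an automorphism `ψ^{[n]} : A^{[n]} → A^{[n]}`, called natural."
A predicate: existence of `Ψ` (representability) is not asserted; uniqueness is `IsNaturalAutomorphism.unique`.
[cite: BoissiereNieperWisskirchenSarti2011, §3.1 (natural automorphisms ψ^{[n]})] [cite: Boissiere2012, §1 (automorphismes naturels)] -/
def IsNaturalAutomorphism (Ξ : (A.X ⊗ H).left.IdealSheafData) (ψ : A.X ≅ A.X) (Ψ : H ⟶ H) : Prop :=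
  Ξ.comap (A.X ◁ Ψ).left = Ξ.comap (ψ.inv ▷ H).left

/-- Unfolding of `IsNaturalAutomorphism`. [cite: BoissiereNieperWisskirchenSarti2011, §3.1] -/
theorem isNaturalAutomorphism_iff (Ξ : (A.X ⊗ H).left.IdealSheafData) (ψ : A.X ≅ A.X) (Ψ : H ⟶ H) :
    IsNaturalAutomorphism Ξ ψ Ψ ↔ Ξ.comap (A.X ◁ Ψ).left = Ξ.comap (ψ.inv ▷ H).left :=
  Iff.rfl

/-- **The identity is the natural automorphism induced by the identity** (`id^{[n]} = id`); in particular the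
predicate is inhabited. [cite: BoissiereNieperWisskirchenSarti2011, §3.1] -/
theorem isNaturalAutomorphism_refl (Ξ : (A.X ⊗ H).left.IdealSheafData) :
    IsNaturalAutomorphism Ξ (Iso.refl A.X) (𝟙 H) := by
  rw [isNaturalAutomorphism_iff, Iso.refl_inv, MonoidalCategory.whiskerLeft_id, MonoidalCategory.id_whiskerRight]

/-- **Uniqueness of the natural automorphism** induced by `ψ` (universal property of the Hilbert scheme: a morphism
to `H` is determined by the family it classifies). [cite: BoissiereNieperWisskirchenSarti2011, §3.1 ("the map Aut(A) → Aut(A^{[n]}), ψ ↦ ψ^{[n]}")]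
[cite: StacksProject, Tag 0B94] -/
theorem IsNaturalAutomorphism.unique {n : ℕ} {Ξ : (A.X ⊗ H).left.IdealSheafData}
    (hH : IsHilbertSchemeOfPoints n A.X H Ξ) {ψ : A.X ≅ A.X} {Ψ Ψ' : H ⟶ H}
    (h : IsNaturalAutomorphism Ξ ψ Ψ) (h' : IsNaturalAutomorphism Ξ ψ Ψ') : Ψ = Ψ' :=
  hH.hom_ext (h.trans h'.symm)

/-- **Natural automorphisms compose**: if `Ψ = ψ^{[n]}` and `Ψ' = ψ'^{[n]}` then `Ψ ≫ Ψ' = (ψ ≫ ψ')^{[n]}`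
(`ψ ↦ ψ^{[n]}` is a homomorphism). [cite: BoissiereNieperWisskirchenSarti2011, §3.1 and Cor. 3.3 (1)] -/
theorem IsNaturalAutomorphism.comp {Ξ : (A.X ⊗ H).left.IdealSheafData} {ψ ψ' : A.X ≅ A.X} {Ψ Ψ' : H ⟶ H}
    (h : IsNaturalAutomorphism Ξ ψ Ψ) (h' : IsNaturalAutomorphism Ξ ψ' Ψ') :
    IsNaturalAutomorphism Ξ (ψ ≪≫ ψ') (Ψ ≫ Ψ') := by
  rw [isNaturalAutomorphism_iff] at h h' ⊢
  rw [MonoidalCategory.whiskerLeft_comp, Over.comp_left, AlgebraicGeometry.Scheme.IdealSheafData.comap_comp, h',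
    ← AlgebraicGeometry.Scheme.IdealSheafData.comap_comp, ← Over.comp_left, whisker_exchange, Over.comp_left,
    AlgebraicGeometry.Scheme.IdealSheafData.comap_comp, h, ← AlgebraicGeometry.Scheme.IdealSheafData.comap_comp, ← Over.comp_left,
    ← MonoidalCategory.comp_whiskerRight, Iso.trans_inv]

end Natural

/-! ### The four single-source pieces (named facts) -/

/-- **S8a — BNWS 2011: a Kummer translation by a torsion point is an automorphism of `Kⁿ(A)` acting trivially on
`H²`.**  Setting of `BNWS2011_autFixingH2H3_generalizedKummer` (`A` an abelian surface, `2 ≤ n`, `(H, Ξ) = A^[n+1]`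
with translation action `act`, `j : K ⟶ H` a Kummer fibre): for every point `b` of `A` with `b^{n+1} = 1` and every
`τ : K ⟶ K` with `τ ≫ j = j ≫ t_b^{[n+1]}`, `τ` is an isomorphism and `τ^* = 𝟙` on `H²(K(ℂ); ℂ)`.  PRINT (one
paper): "the translation `t_a` by `a` in `A` induces an automorphism of `A^{[n]}` that restricts to `K_n(A)` if and
only if `a` is an `n`-torsion point of `A`" (§3.1) and "the translation by `a` on `A` induces an automorphism
`t_a^{⟦n⟧}` acting as the identity on `H²(K_n(A), ℤ)`: since the automorphism `t_a^{[n]}` induced on `A^{[n]}` is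
homotopic to the identity and the restriction map `H²(A^{[n]}, ℂ) → H²(K_n(A), ℂ)` is surjective, `t_a^{⟦n⟧}` acts as
the identity on `H²(K_n(A), ℂ)`" (proof of Cor. 3.3 (2); BNWS's `K_n(A) ⊂ A^{[n]}`, `n ≥ 3` = the tree's `Kⁿ(A)`,
`n + 1 ≥ 3`).  A THEOREM in print; unproved in the tree (the `im θ^*`-part of the `H²` statement is the fact-free
`IsKummerTranslation.complexBetti_map_comp_pullback`; surjectivity of `θ^*` in degree 2 is Beauville 1983 Prop. 8).
[cite: BoissiereNieperWisskirchenSarti2011, §3.1 (p. 6) and Cor. 3.3 (2) with its proof (p. 8)] -/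
def BNWS2011_kummerTranslation_isIso_trivialOnH2 : Prop :=
  ∀ ⦃n : ℕ⦄ ⦃A : AbelianVariety ℂ⦄ ⦃K H : SchemeOver ℂ⦄, A.dim = 2 → 2 ≤ n →
    ∀ (Ξ : (A.X ⊗ H).left.IdealSheafData) (𝒜 : Motives.Jacobian H) (x₀ : 𝟙_ (SchemeOver ℂ) ⟶ H) (j : K ⟶ H)
      (act : A.X ⊗ H ⟶ H), IsHilbertSchemeOfPoints (n + 1) A.X H Ξ →
      Motives.IsSmoothProjective (2 * (n + 1)) H →
      IsPullback j (toUnit K) (lift (𝟙 H) (toUnit H ≫ x₀) ≫ 𝒜.diff) (1 : 𝟙_ (SchemeOver ℂ) ⟶ 𝒜.J.X) →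
      Motives.IsSmoothProjective (2 * n) K → IsTranslationAction Ξ act →
      ∀ (b : 𝟙_ (SchemeOver ℂ) ⟶ A.X) (τ : K ⟶ K), b ^ (n + 1) = 1 → IsKummerTranslation act j b τ →
        IsIso τ ∧ complexBetti.map τ 2 = 𝟙 _

/-- **S8d — Foster 2024: the torsion translations act trivially on `H³(Kⁿ(A))`.**  Same setting: for every point
`b` with `b^{n+1} = 1` and every Kummer translation `τ` by `b` (`τ ≫ j = j ≫ t_b^{[n+1]}`), `τ^* = 𝟙` on
`H³(K(ℂ); ℂ)`.  PRINT (one paper): "The group `A[n+1]` of torsion points of `A` of order `n+1` acts on `A^{[n+1]}`.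
The Albanese map is invariant with respect to this action. Hence, `A[n+1]` embeds into `Aut_0(Kum_n(A))`" (Remark 28,
p. 8) and, in the proof of Lemma 85 with `Γ ≅ A[n+1]` this group and `j > 1` the smallest prime divisor of `n + 1`:
"if `k < 2(n+1)(j−1)/j`, then `H^k(A × Kum_n(A), ℚ)` is `Γ`-invariant and by the Künneth theorem this implies that
`H^k(Kum_n(A), ℚ)` is `Γ`-invariant as well" — `k = 3 < 2(n+1)(j−1)/j` for every `n ≥ 2` (`n + 1 = 3`: bound `4`;
`j = 2`: bound `n + 1 ≥ 4`; `j ≥ 3`: bound `≥ 4(n+1)/3 ≥ 4`); rational coefficients give complex coefficients by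
extension of scalars (`H³(·; ℂ) = H³(·; ℚ) ⊗ ℂ`).  Foster's `Kum_n(A) ⊂ A^{[n+1]}` = the tree's `Kⁿ(A)`.  A THEOREM in
print (there: the degree-`< 2(n+1)(j−1)/j` statement; here only its instance `k = 3`, Lean-WEAKER); unproved in the
tree (for manifolds of `Kumⁿ`-TYPE and the abstract group `Γ(X)` the tree records the cognate fact
`GeneralizedKummerTypeTranslationActionOnCohomology`). [cite: Foster2024, Remark 28 (p. 8) and Lemma 85 with its proof (pp. 24–25)] -/
def Foster2024_kummerTranslation_trivialOnH3 : Prop :=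
  ∀ ⦃n : ℕ⦄ ⦃A : AbelianVariety ℂ⦄ ⦃K H : SchemeOver ℂ⦄, A.dim = 2 → 2 ≤ n →
    ∀ (Ξ : (A.X ⊗ H).left.IdealSheafData) (𝒜 : Motives.Jacobian H) (x₀ : 𝟙_ (SchemeOver ℂ) ⟶ H) (j : K ⟶ H)
      (act : A.X ⊗ H ⟶ H), IsHilbertSchemeOfPoints (n + 1) A.X H Ξ →
      Motives.IsSmoothProjective (2 * (n + 1)) H →
      IsPullback j (toUnit K) (lift (𝟙 H) (toUnit H ≫ x₀) ≫ 𝒜.diff) (1 : 𝟙_ (SchemeOver ℂ) ⟶ 𝒜.J.X) →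
      Motives.IsSmoothProjective (2 * n) K → IsTranslationAction Ξ act →
      ∀ (b : 𝟙_ (SchemeOver ℂ) ⟶ A.X) (τ : K ⟶ K), b ^ (n + 1) = 1 → IsKummerTranslation act j b τ →
        complexBetti.map τ 3 = 𝟙 _

/-- **S8b — BNWS 2011 Cor. 3.3 (2) (= Oguiso 2020 Thm. 1.2): an automorphism of `Kⁿ(A)` acting trivially on `H²` is
NATURAL, induced by `t_a ∘ (±1)_A`.**  Same setting: for every automorphism `g` of `K` with `g^* = 𝟙` on
`H²(K(ℂ); ℂ)`, EITHER `g` is the Kummer translation by a point `b` with `b^{n+1} = 1` (`g ≫ j = j ≫ t_b^{[n+1]}`), OR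
`g` is the restriction of the natural automorphism `Ψ = ψ^{[n+1]}` of `A^[n+1]` induced by an involution
`ψ : x ↦ x⁻¹ · d` of `A` (`IsNaturalAutomorphism Ξ (invTranslateIso A d) Ψ` and `g ≫ j = j ≫ Ψ`).  PRINT: "The kernel
of the map `Aut(K_n(A)) → O(H²(K_n(A), ℤ))`, `f ↦ f^*` is isomorphic to `Tors_n(A) ⋊ ℤ/2ℤ`" (Cor. 3.3 (2)); proof:
"Assume `f ∈ Aut(K_n(A))` acts as the identity on `H²(K_n(A), ℤ)`. […] `f` leaves `E_0` globally invariant, so by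
Theorem 3.1 it is a natural automorphism [`= (t_a ∘ h)^{⟦n⟧}`, `a ∈ Tors_n(A)`, `h ∈ GAut(A)`] […] The only possibility
is `λ = μ = ±1`, so `f = ±id`"; restated by Oguiso as "`Ker (ρ₂ : Aut(K_{n−1}(A)) → GL(H²(K_{n−1}(A), ℤ))) = T(n)·⟨ι⟩`.
Here `ι` is the automorphism naturally induced from the inversion `−1` of `A`".  Integral vs complex coefficients:
"`H²(K_n(A), ℤ)` has no torsion" (BNWS, same proof), so `f^* = id` on `H²(·, ℂ)` iff on `H²(·, ℤ)`.  At a general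
Kummer fibre (a translate `t_c^{[n+1]}` of the fibre over `0`, Beauville 1983 §7) the conjugates of `ι` are the
natural automorphisms of the involutions `x ↦ x⁻¹ · d` — whence the parameter `d`.  Only the inclusion
`Ker ρ₂ ⊆ T·⟨ι⟩` is recorded (Lean-WEAKER than the printed equality; the converse for translations is
`BNWS2011_kummerTranslation_isIso_trivialOnH2`).  A THEOREM in print (BNWS need `n + 1 ≥ 3`, i.e. the tree's
`n ≥ 2`); unproved in the tree. [cite: BoissiereNieperWisskirchenSarti2011, Cor. 3.3 (2) (p. 7) with its proof (p. 8), Thm. 3.1 and §3.1]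
[cite: Oguiso2020CohomologicallyTrivialKummer, Thm. 1.2 (p. 3)] [cite: Beauville1983, §7 p. 769 (the fibres of S are translates of one another)] -/
def BNWS2011_autTrivialOnH2_generalizedKummer : Prop :=
  ∀ ⦃n : ℕ⦄ ⦃A : AbelianVariety ℂ⦄ ⦃K H : SchemeOver ℂ⦄, A.dim = 2 → 2 ≤ n →
    ∀ (Ξ : (A.X ⊗ H).left.IdealSheafData) (𝒜 : Motives.Jacobian H) (x₀ : 𝟙_ (SchemeOver ℂ) ⟶ H) (j : K ⟶ H)
      (act : A.X ⊗ H ⟶ H), IsHilbertSchemeOfPoints (n + 1) A.X H Ξ →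
      Motives.IsSmoothProjective (2 * (n + 1)) H →
      IsPullback j (toUnit K) (lift (𝟙 H) (toUnit H ≫ x₀) ≫ 𝒜.diff) (1 : 𝟙_ (SchemeOver ℂ) ⟶ 𝒜.J.X) →
      Motives.IsSmoothProjective (2 * n) K → IsTranslationAction Ξ act →
      ∀ g : Aut K, complexBetti.map g.hom 2 = 𝟙 _ →
        (∃ b : 𝟙_ (SchemeOver ℂ) ⟶ A.X, b ^ (n + 1) = 1 ∧ IsKummerTranslation act j b g.hom) ∨
        (∃ (d : 𝟙_ (SchemeOver ℂ) ⟶ A.X) (Ψ : H ⟶ H),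
          IsNaturalAutomorphism Ξ (A.invTranslateIso d) Ψ ∧ g.hom ≫ j = j ≫ Ψ)

/-- **S8c — Oguiso 2020 Lemma 3.4: the coset of `ι` acts non-trivially on `H³(Kⁿ(A); ℂ)`.**  Same setting: an
automorphism `g` of `K` that is the restriction of the natural automorphism `Ψ = ψ^{[n+1]}` induced by an involution
`ψ : x ↦ x⁻¹ · d` of `A` (`IsNaturalAutomorphism Ξ (invTranslateIso A d) Ψ`, `g ≫ j = j ≫ Ψ`) does NOT act as the
identity on `H³(K(ℂ); ℂ)`.  PRINT: "Lemma 3.4. Let `g ∈ K ∖ T(n)` and `τ ∈ H^{2,1}(X)` be as in Lemma 3.3. Then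
`g^* τ = −τ`. In particular, `g` is not cohomologically trivial. […] Since `τ ≠ 0` in `H^{2,1}(X)`, this implies
`g^* | H³(X, ℂ) ≠ id`" (`X = K_{n−1}(A) ⊂ Hilb^n(A)` the fibre over `0`, `n − 1 ≥ 2`; `K = T(n)·⟨ι⟩`, so `K ∖ T(n)` is
the coset `T(n)·ι` = the natural automorphisms of the maps `x ↦ −x + a`, `a ∈ A[n]`; at a general fibre — a translate
of `X` by some `t_c^{[n]}`, all fibres being isomorphic (§2) — these are the natural automorphisms of the involutions
`x ↦ x⁻¹ · d` preserving it).  Only the "in particular" clause is recorded (Lean-WEAKER: the eigenclass `τ` is not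
named).  A THEOREM in print; unproved in the tree. [cite: Oguiso2020CohomologicallyTrivialKummer, Lemma 3.4 (p. 5), with §2 (p. 4) and Thm. 1.2 (p. 3) for the setting]
[cite: Beauville1983, §7 p. 769] -/
def Oguiso2020_inversionCoset_nontrivialOnH3 : Prop :=
  ∀ ⦃n : ℕ⦄ ⦃A : AbelianVariety ℂ⦄ ⦃K H : SchemeOver ℂ⦄, A.dim = 2 → 2 ≤ n →
    ∀ (Ξ : (A.X ⊗ H).left.IdealSheafData) (𝒜 : Motives.Jacobian H) (x₀ : 𝟙_ (SchemeOver ℂ) ⟶ H) (j : K ⟶ H)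
      (act : A.X ⊗ H ⟶ H), IsHilbertSchemeOfPoints (n + 1) A.X H Ξ →
      Motives.IsSmoothProjective (2 * (n + 1)) H →
      IsPullback j (toUnit K) (lift (𝟙 H) (toUnit H ≫ x₀) ≫ 𝒜.diff) (1 : 𝟙_ (SchemeOver ℂ) ⟶ 𝒜.J.X) →
      Motives.IsSmoothProjective (2 * n) K → IsTranslationAction Ξ act →
      ∀ (g : Aut K) (d : 𝟙_ (SchemeOver ℂ) ⟶ A.X) (Ψ : H ⟶ H),
        IsNaturalAutomorphism Ξ (A.invTranslateIso d) Ψ → g.hom ≫ j = j ≫ Ψ →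
          complexBetti.map g.hom 3 ≠ 𝟙 _

/-! ### The glue (G8): the four pieces give the synthesis fact -/

/-- **G8 — `Γ(Kⁿ(A))` = the torsion translations, DERIVED from the four single-source pieces.**  Clause (1) of
`BNWS2011_autFixingH2H3_generalizedKummer` is S8a (isomorphism, trivial on `H²`) ∧ S8d (trivial on `H³`); clause (2):
an automorphism trivial on `H²` and `H³` is, by S8b, a torsion translation or in the coset of `ι`, and the latter is
excluded by S8c.  Pure bookkeeping — the "intersection step" of the print synthesis, now kernel-checked.
[cite: BoissiereNieperWisskirchenSarti2011, Cor. 3.3 (2)] [cite: Oguiso2020CohomologicallyTrivialKummer, Thm. 1.2 and Lemma 3.4]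
[cite: Foster2024, Lemma 85 (proof)] -/
theorem bnws2011_autFixingH2H3_generalizedKummer_of_pieces
    (h₁ : BNWS2011_kummerTranslation_isIso_trivialOnH2) (h₂ : Foster2024_kummerTranslation_trivialOnH3)
    (h₃ : BNWS2011_autTrivialOnH2_generalizedKummer) (h₄ : Oguiso2020_inversionCoset_nontrivialOnH3) :
    BNWS2011_autFixingH2H3_generalizedKummer := by
  intro n A K H hA hn Ξ 𝒜 x₀ j act hH hHs hsq hKs hact
  refine ⟨fun b τ hb hτ => ?_, fun g hg => ?_⟩
  · obtain ⟨hiso, h2⟩ := h₁ hA hn Ξ 𝒜 x₀ j act hH hHs hsq hKs hact b τ hb hτ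
    exact ⟨hiso, h2, h₂ hA hn Ξ 𝒜 x₀ j act hH hHs hsq hKs hact b τ hb hτ⟩
  · obtain ⟨hg2, hg3⟩ := (mem_autFixingH2H3_iff g).1 hg
    rcases h₃ hA hn Ξ 𝒜 x₀ j act hH hHs hsq hKs hact g hg2 with ⟨b, hb, hτ⟩ | ⟨d, Ψ, hΨ, hgj⟩
    · exact ⟨b, hb, hτ⟩
    · exact absurd hg3 (h₄ hA hn Ξ 𝒜 x₀ j act hH hHs hsq hKs hact g d Ψ hΨ hgj)

/-! ### Appended 2026-09-01 (K5 wave 3, k5-ext-typer-1): `Aut₀(Kⁿ(A)) = Γ ∪ {involutions}` — the order-two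
half of BNWS Cor. 3.3 (2) made kernel, and its use at the Kummer end of the `F125X` chain -/

section KummerEnd

variable {n : ℕ} {A : AbelianVariety ℂ} {K H : SchemeOver ℂ} {Ξ : (A.X ⊗ H).left.IdealSheafData}
  {𝒜 : Motives.Jacobian H} {x₀ : 𝟙_ (SchemeOver ℂ) ⟶ H} {j : K ⟶ H} {act : A.X ⊗ H ⟶ H}

/-- **The natural automorphism of an involution `x ↦ x⁻¹ · d` is an involution**: if `Ψ = ψ^{[n]}` for
`ψ = invTranslateIso A d` then `Ψ ≫ Ψ = 𝟙` (`ψ ≫ ψ = 𝟙`, `IsNaturalAutomorphism.comp`, uniqueness).  The `ℤ/2ℤ` of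
"`Tors_n(A) ⋊ ℤ/2ℤ`". [cite: BoissiereNieperWisskirchenSarti2011, Cor. 3.3 (1)–(2)] [cite: Oguiso2020CohomologicallyTrivialKummer, Thm. 1.2] -/
theorem IsNaturalAutomorphism.comp_self_eq_id_of_invTranslateIso (hH : IsHilbertSchemeOfPoints n A.X H Ξ)
    {d : 𝟙_ (SchemeOver ℂ) ⟶ A.X} {Ψ : H ⟶ H} (hΨ : IsNaturalAutomorphism Ξ (A.invTranslateIso d) Ψ) :
    Ψ ≫ Ψ = 𝟙 H := by
  have h2 := hΨ.comp hΨ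
  rw [isNaturalAutomorphism_iff, Iso.trans_inv] at h2
  change _ = Ξ.comap ((A.invTranslate d ≫ A.invTranslate d) ▷ H).left at h2
  rw [Motives.AbelianVariety.invTranslate_comp_invTranslate, MonoidalCategory.id_whiskerRight,
    ← MonoidalCategory.whiskerLeft_id] at h2
  exact hH.hom_ext h2

/-- **A Kummer fibre is a closed subscheme**: `j : K ⟶ A^[n+1]`, the pull-back of the point `1` of the Albanese
target, is a monomorphism (pull-back of a morphism out of the terminal object). [cite: Beauville1983, §7 p. 769] -/
theorem mono_of_isPullback_kummerFibre
    (hsq : IsPullback j (toUnit K) (lift (𝟙 H) (toUnit H ≫ x₀) ≫ 𝒜.diff) (1 : 𝟙_ (SchemeOver ℂ) ⟶ 𝒜.J.X)) :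
    Mono j :=
  hsq.mono_fst_of_mono (inst := CartesianMonoidalCategory.isTerminalTensorUnit.mono_from _)

/-- **`Aut₀(Kⁿ(A)) = Γ(Kⁿ(A)) ∪ {involutions}`** (BNWS Cor. 3.3 (2) / Oguiso Thm. 1.2, the group structure
`T(n+1) ⋊ ⟨ι⟩` read off): under S8d and S8b, an automorphism `g` of `K = Kⁿ(A)` acting trivially on `H²(K(ℂ); ℂ)`
either lies in `Γ(K)` (it is a torsion translation, trivial on `H³` by Foster) or satisfies `g² = 1` (it is the
restriction of the natural automorphism of an involution `x ↦ x⁻¹ · d`, itself an involution, and `j` is mono).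
[cite: BoissiereNieperWisskirchenSarti2011, Cor. 3.3 (2)] [cite: Oguiso2020CohomologicallyTrivialKummer, Thm. 1.2]
[cite: Foster2024, Lemma 85 (proof)] -/
theorem mem_autFixingH2H3_or_sq_eq_one_of_trivialOnH2
    (h₂ : Foster2024_kummerTranslation_trivialOnH3)
    (h₃ : BNWS2011_autTrivialOnH2_generalizedKummer) (hA : A.dim = 2) (hn : 2 ≤ n)
    (hH : IsHilbertSchemeOfPoints (n + 1) A.X H Ξ) (hHs : Motives.IsSmoothProjective (2 * (n + 1)) H)
    (hsq : IsPullback j (toUnit K) (lift (𝟙 H) (toUnit H ≫ x₀) ≫ 𝒜.diff) (1 : 𝟙_ (SchemeOver ℂ) ⟶ 𝒜.J.X))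
    (hKs : Motives.IsSmoothProjective (2 * n) K) (hact : IsTranslationAction Ξ act)
    (g : Aut K) (hg2 : complexBetti.map g.hom 2 = 𝟙 _) :
    g ∈ autFixingH2H3 K ∨ g * g = 1 := by
  rcases h₃ hA hn Ξ 𝒜 x₀ j act hH hHs hsq hKs hact g hg2 with ⟨b, hb, hτ⟩ | ⟨d, Ψ, hΨ, hgj⟩
  · exact Or.inl ⟨hg2, h₂ hA hn Ξ 𝒜 x₀ j act hH hHs hsq hKs hact b g.hom hb hτ⟩
  · right
    haveI := mono_of_isPullback_kummerFibre hsq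
    have hΨΨ := IsNaturalAutomorphism.comp_self_eq_id_of_invTranslateIso hH hΨ
    have hgg : (g.hom ≫ g.hom) ≫ j = 𝟙 K ≫ j := by
      rw [Category.assoc, hgj, ← Category.assoc, hgj, Category.assoc, hΨΨ, Category.comp_id, Category.id_comp]
    have hgg' : g.hom ≫ g.hom = 𝟙 K := (cancel_mono j).1 hgg
    exact Iso.ext hgg'

/-- **Corollary used at the Kummer end of `F125X`**: an automorphism of `Kⁿ(A)` trivial on `H²` whose order does
not divide `2` (e.g. of order `5`) lies in `Γ(Kⁿ(A))` — in `T(n+1) ⋊ ⟨ι⟩` the coset of `ι` consists of involutions.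
[cite: BoissiereNieperWisskirchenSarti2011, Cor. 3.3 (2)] [cite: Oguiso2020CohomologicallyTrivialKummer, Thm. 1.2 and Prop. 3.6 (a ∈ T(n) of order p)] -/
theorem mem_autFixingH2H3_of_trivialOnH2_of_not_orderOf_dvd_two
    (h₂ : Foster2024_kummerTranslation_trivialOnH3)
    (h₃ : BNWS2011_autTrivialOnH2_generalizedKummer) (hA : A.dim = 2) (hn : 2 ≤ n)
    (hH : IsHilbertSchemeOfPoints (n + 1) A.X H Ξ) (hHs : Motives.IsSmoothProjective (2 * (n + 1)) H)
    (hsq : IsPullback j (toUnit K) (lift (𝟙 H) (toUnit H ≫ x₀) ≫ 𝒜.diff) (1 : 𝟙_ (SchemeOver ℂ) ⟶ 𝒜.J.X))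
    (hKs : Motives.IsSmoothProjective (2 * n) K) (hact : IsTranslationAction Ξ act)
    (g : Aut K) (hg2 : complexBetti.map g.hom 2 = 𝟙 _) (hord : ¬ orderOf g ∣ 2) :
    g ∈ autFixingH2H3 K := by
  rcases mem_autFixingH2H3_or_sq_eq_one_of_trivialOnH2 h₂ h₃ hA hn hH hHs hsq hKs hact g hg2 with hmem | hsq1
  · exact hmem
  · exact absurd (orderOf_dvd_of_pow_eq_one (by rw [pow_two, hsq1])) hord

end KummerEnd

end Literature.AlgebraicGeometry.Hyperkaehler

end
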